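import Mathlib.Data.Nat.Choose.Sum
import Mathlib.Data.Nat.Choose.Vandermonde
import Mathlib.Data.Fintype.CardEmbedding
import Mathlib.Algebra.BigOperators.Intervals
import Literature.AlgebraicGeometry.HodgeTheory.AbelianVarietyHodgeNumbers
import HarnessLib

/-!
# Venture HSemireg — (S5) OBSTRUCTION LOCUS away from secant type, XLVII: the GLOBAL COUNT LAYER of
# EXT-NOTE §6.C–§6.E — every printed dimension of the `E₂` page `H^p(X, 𝓔xt^q(I_Z, I_Z))` at `X = Eⁿ` is
# ONE closed form `E₂^{p,q}(n, m) = C(m, q) · n!/(n−2q)! · C(n−2q, p)`, all `n`, all `m`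

HONEST FRAMING.  Part of the Lean side of the computation cell `pub-hsemireg` (track «S4-PUSH» (ii), seat
s4-prove-2).  Elementary combinatorics over `ℕ` / `ℤ` plus one dictionary line to the tree's Hodge numbers of
abelian varieties; nothing here constructs a variety, a sheaf or a spectral sequence; nothing here says that
HC / HC_CM / HC_AV holds; no Literature fact is declared; no object is certified.  (S5)'s status word («MODEL-LEVEL
theorems modulo the named shapes (H-arr), (H-NC)») is unchanged.  What moves: the numbers of EXT-NOTE §6.C (1)(2)(3),
§6.D (the `E₂` page, (ii), (γ)) and §6.E — a seat derivation, engine-checked for `n ≤ 5` — become corollaries of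
one closed form for every `n` and every number `m` of translates.

DICTIONARY (kernel vs. BINDER).  `X = Eⁿ`, `W = ⋃_{i<j} B_{ij}`, `Z = ⋃_{t ∈ T} (W + t)`, `|T| = m`, (GEN) as in
EXT-NOTE §6.0.  §6.B(c) is kernel at every point for the affine block models (files XXIX `q = 1`, XXXV `q = r = 2`,
XXXVII `q = r`, XLIV `extEquiv` every `q`: `Ext^q_R(I_M, I_M) ≃ Π_{τ ∈ PBT(M,q)} R ⧸ J_τ`), so `𝓔xt^q(I_Z, I_Z)` is a
sum of structure sheaves of `q`-fold crossing loci, one summand per ORIENTED crossing type: a `q`-set `J ⊆ T`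
(`C(m,q)` of them) and for each `t ∈ J` an ORDERED coordinate pair `(a_t, b_t)` (a branch, file XIX / XLIII), the
unordered pairs pairwise disjoint — an injective map `J × {0,1} ↪ {1,…,n}`, `n!/(n−2q)!` of them
(`card_orientedCrossingType`; `2^q` orientations per unoriented type = file XLV `card_pbt_of_card_eq_two`).  Each
locus `B_1 ∩ ⋯ ∩ B_q` is a translated abelian subvariety `≅ E^{n−2q}` with `h^p(𝒪) = h^{0,p} = C(n−2q, p)` — the
tree's PROVED Hodge number of an abelian variety (`HodgeModel.finrank_typePiece_eq_choose_mul_choose`; here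
`ePage_eq_mul_finrank_typePiece`).  BINDERS (prose only): the global summand structure of `𝓔xt^q` (§6.B(c)
sheafified + (GEN)), `H^p` of a direct image, and §6.D(i)'s degeneration `E₂ = E_∞`, whose one-line mechanism
«a map equivariant between the scalars `(−1)^k` and `(−1)^{k+1}` is zero» is `eq_zero_of_smul_eq_neg_smul`; under
them `e_k = ext^k(I_Z, I_Z) = Σ_{p+q=k} E₂^{p,q}` (`eTot`) and the `Γ_tr`-invariant counts are `eInvTot` (`Γ_tr`, of
order `m`, acts freely on the summands with `q ≥ 1`: `mul_eInv`).  `chi` is the Euler characteristic of the page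
(`= Σ_k (−1)^k e_k` with or without degeneration).

CONTENT (namespace `Summit.Ventures.HSemireg.ObstructionLocus.GlobalCount`; every number of §6.C–§6.E has its own
declaration and docstring below): `OrientedCrossingType` / `card_orientedCrossingType` / `pair`; the entry `ePage` and its
rows `q = 0, 1, 2`, vanishing and duality; totals `eTot` (§6.C (1)(2), §6.D (ii) for `W` at every `n` and the printed rows
at `n = 4, 5, 6`); `chi_eq` (`χ(n,m) = (−1)^{n/2} C(m,n/2) n!` for even `n`, `0` for odd `n`); invariants `eInv` /
`eInvTot` (§6.C (3) `e₁^Γ = n²`, §6.D (γ) `e₂^Γ = C(n,2) + n(n−1)(n−2) + 12C(n,4)(m−1)`); §6.E (Vandermonde);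
§6.D(i)'s mechanism; the Hodge-number dictionary.
References (dictionary only): EXT-NOTE.md §6.0, §6.B(c), §6.C–§6.E (cell pub-hsemireg, general-structure/); files
XIX, XXIX, XXXV, XXXVII, XLIII–XLV of this series.  No source is followed; the identities are elementary.
-/

open Finset
open scoped BigOperators Nat

namespace Summit.Ventures.HSemireg.ObstructionLocus.GlobalCount

/-! ## 1. Oriented `q`-fold crossing types -/

/-- An ORIENTED `q`-fold crossing type in `n` coordinates: `q` ordered pairs of coordinates, all `2q` entries
distinct — an injective map `Fin q × Fin 2 ↪ Fin n`.  Dictionary: with a `q`-set of translates it names one summand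
`𝒪_{B_1 ∩ ⋯ ∩ B_q}` of `𝓔xt^q(I_Z, I_Z)` (§6.B(c); an orientation = a partial branch tuple of file XLIII). -/
abbrev OrientedCrossingType (n q : ℕ) : Type := (Fin q × Fin 2) ↪ Fin n

/-- **There are `n!/(n−2q)!` oriented `q`-fold crossing types** (`= n.descFactorial (2q)`; `0` iff `n < 2q`). -/
theorem card_orientedCrossingType (n q : ℕ) :
    Fintype.card (OrientedCrossingType n q) = n.descFactorial (2 * q) := by
  rw [Fintype.card_embedding_eq, Fintype.card_prod, Fintype.card_fin, Fintype.card_fin, Fintype.card_fin,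
    mul_comm]

variable {n q : ℕ}
/-- The `i`-th (unordered) coordinate pair `{a_i, b_i}` of an oriented crossing type. -/
def pair (e : OrientedCrossingType n q) (i : Fin q) : Finset (Fin n) := {e (i, 0), e (i, 1)}

/-- Each coordinate pair of an oriented crossing type is a 2-set (a codimension-2 component `B_{ab}`, `a ≠ b`). -/
theorem card_pair (e : OrientedCrossingType n q) (i : Fin q) : (pair e i).card = 2 := by
  refine Finset.card_pair fun h => ?_
  exact absurd (congrArg Prod.snd (e.injective h)) Fin.zero_ne_one

/-- The coordinate pairs of an oriented crossing type are pairwise disjoint (the (GEN) shape of a `q`-fold crossing: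
`q` components from `q` distinct translates with pairwise disjoint index pairs). -/
theorem disjoint_pair (e : OrientedCrossingType n q) {i j : Fin q} (h : i ≠ j) :
    Disjoint (pair e i) (pair e j) := by
  rw [pair, pair, Finset.disjoint_left]
  intro a ha hb
  simp only [Finset.mem_insert, Finset.mem_singleton] at ha hb
  rcases ha with rfl | rfl <;> rcases hb with hb | hb <;> exact h (congrArg Prod.fst (e.injective hb))

/-! ## 2. The `E₂` entry -/
/-- **`E₂^{p,q}(n, m) = C(m, q) · n!/(n−2q)! · C(n−2q, p)`** — the dimension of `H^p(X, 𝓔xt^q(I_Z, I_Z))` for a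
(GEN) arrangement of `m` translates of `W` in `X = Eⁿ`: `C(m,q)` choices of `q` translates, `n!/(n−2q)!` oriented
crossing types, `h^p(𝒪_{E^{n−2q}}) = C(n−2q, p)` (EXT-NOTE §6.D prints the rows `q ≤ 2` and «`E₂^{p,q}`, `q ≥ 3`, from
`q`-fold crossings (`n ≥ 2q`)»; the all-`q` closed form is the same count; for `n < 2q` the middle factor vanishes, so
the `ℕ`-subtraction is harmless: `ePage_eq_zero_of_lt`). -/
def ePage (n m p q : ℕ) : ℕ := m.choose q * n.descFactorial (2 * q) * (n - 2 * q).choose p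

/-- `E₂^{p,q}` as a count: (`q`-subsets of the `m` translates) × (oriented crossing types) × `C(n−2q, p)`. -/
theorem ePage_eq_card (n m p q : ℕ) : ePage n m p q = ((Finset.univ : Finset (Fin m)).powersetCard q).card
      * Fintype.card (OrientedCrossingType n q) * (n - 2 * q).choose p := by
  rw [Finset.card_powersetCard, Finset.card_univ, Fintype.card_fin, card_orientedCrossingType, ePage]

/-- No `q`-fold crossings for `n < 2q`: `E₂^{p,q} = 0`. -/
theorem ePage_eq_zero_of_lt {n q : ℕ} (h : n < 2 * q) (m p : ℕ) : ePage n m p q = 0 := by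
  rw [ePage, (Nat.descFactorial_eq_zero_iff_lt).2 h, mul_zero, zero_mul]

/-- Fewer than `q` translates: `E₂^{p,q} = 0`. -/
theorem ePage_eq_zero_of_lt_transl {m q : ℕ} (h : m < q) (n p : ℕ) : ePage n m p q = 0 := by
  rw [ePage, Nat.choose_eq_zero_of_lt h, zero_mul, zero_mul]

/-- Row `q = 0`: **`E₂^{p,0} = h^p(𝒪_X) = C(n, p)`**. -/
theorem ePage_zero_right (n m p : ℕ) : ePage n m p 0 = n.choose p := by simp [ePage]

/-- `n!/(n−2)! = 2·C(n,2)` (`= n(n−1)`). -/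
theorem descFactorial_two (n : ℕ) : n.descFactorial 2 = 2 * n.choose 2 := by
  rw [Nat.descFactorial_eq_factorial_mul_choose]; rfl

/-- `c_n := C(n,2) · C(n−2,2) = 6 · C(n,4)` (crossings per ordered pair of translates). -/
theorem choose_two_mul_choose_two (n : ℕ) : n.choose 2 * (n - 2).choose 2 = 6 * n.choose 4 := by
  have h := Nat.choose_mul (n := n) (k := 4) (s := 2) (by norm_num)
  rw [show Nat.choose 4 2 = 6 by rfl, show (4 : ℕ) - 2 = 2 by rfl] at h
  rw [← h, mul_comm]
/-- `n!/(n−4)! = 4 · c_n`. -/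
theorem descFactorial_four (n : ℕ) : n.descFactorial 4 = 4 * (n.choose 2 * (n - 2).choose 2) := by
  rw [Nat.descFactorial_eq_factorial_mul_choose, choose_two_mul_choose_two, show (4 : ℕ)! = 4 * 6 by rfl, mul_assoc]

/-- Row `q = 1`: **`E₂^{p,1} = 2m · C(n,2) · C(n−2, p)`** (`⊕_B H^p(𝒪_B)^{⊕2}` over the `m·C(n,2)` components). -/
theorem ePage_one_right (n m p : ℕ) : ePage n m p 1 = 2 * m * n.choose 2 * (n - 2).choose p := by
  rw [ePage, Nat.choose_one_right, mul_one, descFactorial_two]; ring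

/-- Row `q = 2`: **`E₂^{p,2} = 4 · c_n · C(m,2) · C(n−4, p)`**, `c_n = C(n,2)C(n−2,2)` (`⊕` over the crossings of
`H^p(𝒪_{B ∩ B′})^{⊕4}`, `B ∩ B′ ≅ E^{n−4}`). -/
theorem ePage_two_right (n m p : ℕ) :
    ePage n m p 2 = 4 * (n.choose 2 * (n - 2).choose 2) * m.choose 2 * (n - 4).choose p := by
  rw [ePage, show 2 * 2 = 4 by rfl, descFactorial_four]; ring

/-- **Duality `E₂^{p,q} = E₂^{n−2q−p,q}`** (Serre duality on the crossing loci `≅ E^{n−2q}`; with it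
`e_k = e_{n−k}`, visible in every row below). -/
theorem ePage_dual {n p q : ℕ} (h : 2 * q + p ≤ n) (m : ℕ) : ePage n m (n - 2 * q - p) q = ePage n m p q := by
  rw [ePage, ePage, Nat.choose_symm (by omega)]

/-! ## 3. Totals `e_k = Σ_{p+q=k} E₂^{p,q}` (under §6.D(i)'s degeneration `E₂ = E_∞`) -/

/-- **`e_k(n, m) := Σ_{q=0}^{k} E₂^{k−q,q}(n, m)`** — `ext^k(I_Z, I_Z)` for `m` translates in `Eⁿ` when the spectral
sequence degenerates at `E₂` (EXT-NOTE §6.D(i)(α): all pairwise differences of `T` 2-torsion). -/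
def eTot (n m k : ℕ) : ℕ := ∑ q ∈ range (k + 1), ePage n m (k - q) q

/-- `e₀ = 1` (`E₂^{0,0} = h⁰(𝒪_X) = C(n,0)`: the scalars). -/
theorem eTot_zero (n m : ℕ) : eTot n m 0 = 1 := by simp [eTot, ePage]

/-- §6.C (1): **`h(Z) = hom(I_Z, 𝒪_Z) = E₂^{0,1} = n(n−1)·m`** (`= 2m·C(n,2)`). -/
theorem ePage_zero_one (n m : ℕ) : ePage n m 0 1 = n * (n - 1) * m := by
  rw [ePage, Nat.choose_one_right, mul_one, Nat.descFactorial_succ, Nat.descFactorial_one, Nat.choose_zero_right]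
  ring

/-- §6.D / STRUCTURE (S-B): **`E₂^{1,1}(n, 1) = h¹(𝒩′_W) = n(n−1)(n−2)`** — the count behind the Kodaira piece of file II
(`n(n−1)` components `B_{jk} ≅ E^{n−2}`, `h¹(𝒪_{E^{n−2}}) = n − 2`; the COUNT link II ↔ IX left global in ATTEMPT-2). -/
theorem ePage_one_one_transl (n : ℕ) : ePage n 1 1 1 = n * (n - 1) * (n - 2) := by
  rw [ePage_one_right, mul_one, Nat.choose_one_right, ← descFactorial_two, Nat.descFactorial_succ, Nat.descFactorial_one]
  ring

/-- §6.C (2): **`e₁ = ext¹(I_Z, I_Z) = n + n(n−1)·m`** (`H¹(𝒪_X)·id ⊕ H⁰(𝓝′)`). -/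
theorem eTot_one (n m : ℕ) : eTot n m 1 = n + n * (n - 1) * m := by
  rw [eTot, sum_range_succ, sum_range_succ, sum_range_zero, zero_add, Nat.sub_zero, Nat.sub_self,
    ePage_zero_right, Nat.choose_one_right, ePage_zero_one]

/-- §6.D (ii), the design `W` itself (`m = 1`), every `n`: **`e_{k+1}(I_W, I_W) = C(n, k+1) + 2C(n,2)C(n−2, k)`**
(gs-eng-1's row-7 formula, verified by the engines for `n ≤ 5`; with `eTot_zero`, `e₀ = C(n,0)`). -/
theorem eTot_transl_succ (n k : ℕ) : eTot n 1 (k + 1) = n.choose (k + 1) + 2 * n.choose 2 * (n - 2).choose k := by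
  rw [eTot, sum_range_succ', sum_range_succ']
  have h0 : ∑ q ∈ range k, ePage n 1 (k + 1 - (q + 1 + 1)) (q + 1 + 1) = 0 :=
    sum_eq_zero fun q _ => ePage_eq_zero_of_lt_transl (by omega) _ _
  rw [h0, zero_add, Nat.sub_zero, ePage_zero_right, show k + 1 - (0 + 1) = k by omega, ePage_one_right,
    mul_one, add_comm]

/-- §6.D (ii), `W ⊂ E⁴`: `e = (1, 16, 30, 16, 1)`. -/
theorem eTot_transl_four : (List.range 5).map (eTot 4 1) = [1, 16, 30, 16, 1] := by decide

/-- §6.D (ii), `W ⊂ E⁵`: `e = (1, 25, 70, 70, 25, 1)`. -/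
theorem eTot_transl_five : (List.range 6).map (eTot 5 1) = [1, 25, 70, 70, 25, 1] := by decide

/-- §6.D (ii), `W ⊂ E⁶`: `e = (1, 36, 135, 200, 135, 36, 1)`. -/
theorem eTot_transl_six : (List.range 7).map (eTot 6 1) = [1, 36, 135, 200, 135, 36, 1] := by decide

/-- §6.D (ii), two translates with `t₁ − t₀ ∈ X[2]`, `n = 4`: `e = (1, 4+24, 6+48+24, 4+24, 1) = (1, 28, 78, 28, 1)`
(habitat1 §6(c) to the digit). -/
theorem eTot_four_two : (List.range 5).map (eTot 4 2) = [1, 28, 78, 28, 1] := by decide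

/-- §6.D (ii), three translates in one 2-torsion coset, `n = 4`: `e = (1, 40, 150, 40, 1)`. -/
theorem eTot_four_three : (List.range 5).map (eTot 4 3) = [1, 40, 150, 40, 1] := by decide

/-- §6.D (ii), `n = 5`, `m = 2`: `e = (1, 45, 250, 250, 45, 1)` (habitat1's undecided `d₂` is `0`). -/
theorem eTot_five_two : (List.range 6).map (eTot 5 2) = [1, 45, 250, 250, 45, 1] := by decide

/-! ## 4. The Euler characteristic of the page -/

/-- **`χ(n, m) := Σ_{k=0}^{n} (−1)^k e_k(n, m)`** — the Euler characteristic of the `E₂` page (equal to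
`Σ_k (−1)^k ext^k(I_Z, I_Z)` with or without degeneration). -/
def chi (n m : ℕ) : ℤ := ∑ k ∈ range (n + 1), (-1) ^ k * (eTot n m k : ℤ)

/-- §6.D (ii): `χ = 24` for two 2-torsion translates in `E⁴`, `χ = 72` for three (`= [Z]² − 2∫ch₄(𝒪_Z) = 54 + 18`
by Riemann–Roch in the note), `χ = 0` at `n = 5` (odd Calabi–Yau) — and `χ(W) = 0` in `E⁴`, `E⁶`. -/
theorem chi_values : (chi 4 2, chi 4 3, chi 5 2, chi 4 1, chi 6 1) = (24, 72, 0, 0, 0) := by decide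

/-- The alternating row sum of Pascal's triangle with slack in the range: `Σ_{p=0}^{N} (−1)^p C(a, p) = [a = 0]`, `N ≥ a`. -/
theorem alternating_sum_choose_of_le {a N : ℕ} (h : a ≤ N) :
    ∑ p ∈ range (N + 1), (-1 : ℤ) ^ p * (a.choose p : ℤ) = if a = 0 then 1 else 0 := by
  rw [← Int.alternating_sum_range_choose, eq_comm]
  refine sum_subset (range_subset_range.2 (by omega)) fun p hp hp' => ?_
  rw [mem_range] at hp hp'
  rw [Nat.choose_eq_zero_of_lt (by omega), Nat.cast_zero, mul_zero]

/-- **`χ(n, m) = (−1)^{n/2} · C(m, n/2) · n!` for even `n`, `0` for odd `n`** — every `n`, every `m` (`24 = C(2,2)·4!`,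
`72 = C(3,2)·4!`; only the middle-dimensional crossings `q = n/2`, which are points, contribute). -/
theorem chi_eq (n m : ℕ) :
    chi n m = if Even n then (-1) ^ (n / 2) * (m.choose (n / 2) : ℤ) * (n ! : ℤ) else 0 := by
  -- Step 1: exchange the sums, `k = p + q`.
  have hswap : chi n m = ∑ q ∈ range (n + 1), ∑ k ∈ Ico q (n + 1), (-1) ^ k * (ePage n m (k - q) q : ℤ) := by
    rw [chi]
    simp_rw [eTot, Nat.cast_sum, mul_sum]
    refine sum_comm' fun k q => ?_
    simp only [mem_range, mem_Ico]
    omega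
  rw [hswap]
  -- Step 2: each inner sum is `(−1)^q C(m,q) n^{(2q)} · Σ_p (−1)^p C(n−2q, p)`.
  have hinner : ∀ q ∈ range (n + 1), ∑ k ∈ Ico q (n + 1), (-1) ^ k * (ePage n m (k - q) q : ℤ)
      = if n = 2 * q then (-1) ^ q * (m.choose q : ℤ) * (n ! : ℤ) else 0 := by
    intro q hq
    rw [mem_range] at hq
    rw [sum_Ico_eq_sum_range, show n + 1 - q = (n - q) + 1 by omega]
    have hterm : ∀ p ∈ range (n - q + 1), (-1 : ℤ) ^ (q + p) * (ePage n m (q + p - q) q : ℤ)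
        = (-1) ^ q * (m.choose q : ℤ) * (n.descFactorial (2 * q) : ℤ) * ((-1) ^ p * ((n - 2 * q).choose p : ℤ)) := by
      intro p _
      rw [show q + p - q = p by omega, ePage, pow_add]; push_cast; ring
    rw [sum_congr rfl hterm, ← mul_sum]
    by_cases hn : 2 * q ≤ n
    · rw [alternating_sum_choose_of_le (by omega)]
      by_cases h0 : n - 2 * q = 0
      · have hn' : n = 2 * q := by omega
        rw [if_pos h0, if_pos hn', mul_one, hn', Nat.descFactorial_self]
      · rw [if_neg h0, if_neg (by omega), mul_zero]
    · rw [(Nat.descFactorial_eq_zero_iff_lt).2 (by omega), if_neg (by omega)]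
      simp
  rw [sum_congr rfl hinner]
  -- Step 3: at most one `q` with `n = 2q`.
  by_cases he : Even n
  · obtain ⟨r, hr⟩ := he
    have hr' : n = 2 * r := by omega
    rw [if_pos ⟨r, hr⟩, show n / 2 = r by omega]
    have hcond : ∀ q ∈ range (n + 1), (if n = 2 * q then (-1) ^ q * (m.choose q : ℤ) * (n ! : ℤ) else 0)
        = if r = q then (-1) ^ q * (m.choose q : ℤ) * (n ! : ℤ) else 0 := by
      intro q _
      by_cases hq : r = q
      · rw [if_pos hq, if_pos (by omega)]
      · rw [if_neg hq, if_neg (by omega)]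
    rw [sum_congr rfl hcond, sum_ite_eq, if_pos (mem_range.2 (by omega))]
  · rw [if_neg he]
    refine sum_eq_zero fun q _ => ?_
    rw [if_neg]
    rintro rfl
    exact he ⟨q, two_mul q⟩

/-! ## 5. `Γ_tr`-invariants (EXT-NOTE §6.C (3), §6.D (γ)) -/

/-- **`(E₂^{p,q})^{Γ_tr}(n, m)`**: for `q = 0`, `H^p(𝒪_X)` is invariant (`C(n,p)`); for `q ≥ 1`, `Γ_tr` (order `m`)
acts freely on the summands (on components and, by (GEN), on crossings), so the invariants have dimension
`E₂^{p,q}/m = C(m−1, q−1) · (n!/(n−2q)!)/q · C(n−2q, p)` (`mul_eInv`; exact division, `dvd_descFactorial_two_mul`;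
junk value at `m = 0`, no design, where `(0 − 1).choose (q − 1)` is read in `ℕ`). -/
def eInv (n m p q : ℕ) : ℕ :=
  if q = 0 then n.choose p else (m - 1).choose (q - 1) * (n.descFactorial (2 * q) / q) * (n - 2 * q).choose p

/-- `q ∣ n!/(n−2q)!` (`n!/(n−2q)! = (2q)! · C(n, 2q)`). -/
theorem dvd_descFactorial_two_mul (n : ℕ) {q : ℕ} (hq : 0 < q) : q ∣ n.descFactorial (2 * q) := by
  rw [Nat.descFactorial_eq_factorial_mul_choose]
  exact dvd_mul_of_dvd_left (Nat.dvd_factorial hq (by omega)) _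

/-- **`m · (E₂^{p,q})^Γ = E₂^{p,q}` for `q ≥ 1`** (free action of `Γ_tr` on the summands). -/
theorem mul_eInv (n m p : ℕ) {q : ℕ} (hq : 0 < q) : m * eInv n m p q = ePage n m p q := by
  obtain ⟨q, rfl⟩ := Nat.exists_eq_add_one_of_ne_zero hq.ne'
  rw [eInv, if_neg (Nat.succ_ne_zero q), Nat.add_sub_cancel, ePage]
  obtain ⟨d, hd⟩ := dvd_descFactorial_two_mul n hq
  rw [hd, Nat.mul_div_cancel_left _ hq]
  rcases m with _ | m
  · simp
  · rw [Nat.add_sub_cancel]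
    -- `(m+1) · C(m, q) = C(m+1, q+1) · (q+1)`
    have h := Nat.add_one_mul_choose_eq m q
    calc (m + 1) * (m.choose q * d * (n - 2 * (q + 1)).choose p)
        = ((m + 1) * m.choose q) * d * (n - 2 * (q + 1)).choose p := by ring
      _ = ((m + 1).choose (q + 1) * (q + 1)) * d * (n - 2 * (q + 1)).choose p := by rw [h]
      _ = (m + 1).choose (q + 1) * ((q + 1) * d) * (n - 2 * (q + 1)).choose p := by ring

/-- Row `q = 0` of the invariant page: `H^p(𝒪_X)`, `C(n, p)`. -/
theorem eInv_zero_right (n m p : ℕ) : eInv n m p 0 = n.choose p := by simp [eInv]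

/-- §6.D: **`(E₂^{p,1})^Γ = 2 · C(n,2) · C(n−2, p)`** (every `m ≥ 1`). -/
theorem eInv_one_right (n m p : ℕ) : eInv n m p 1 = 2 * n.choose 2 * (n - 2).choose p := by
  rw [eInv, if_neg one_ne_zero, Nat.sub_self, Nat.choose_zero_right, one_mul, mul_one, Nat.div_one,
    descFactorial_two]

/-- §6.D: **`(E₂^{p,2})^Γ = 4 · (c_n (m−1)/2) · C(n−4, p) = 2 · C(n,2)C(n−2,2) · (m−1) · C(n−4, p)`**. -/
theorem eInv_two_right (n m p : ℕ) :
    eInv n m p 2 = 2 * (n.choose 2 * (n - 2).choose 2) * (m - 1) * (n - 4).choose p := by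
  rw [eInv, if_neg two_ne_zero, show 2 * 2 = 4 by rfl, descFactorial_four, Nat.choose_one_right,
    show (4 : ℕ) = 2 * 2 by rfl, mul_assoc 2 2, Nat.mul_div_cancel_left _ two_pos]
  ring

/-- **`e_k^Γ(n, m) := Σ_{q=0}^{k} (E₂^{k−q,q})^Γ`** — `ext^k(F_d, F_d)^{Γ_tr}` under degeneration of the invariant
rows (EXT-NOTE §6.D(i)(β): rows `q ≤ 1` always; the crossing rows for 2-torsion `Γ_tr`). -/
def eInvTot (n m k : ℕ) : ℕ := ∑ q ∈ range (k + 1), eInv n m (k - q) q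

/-- §6.C (3): **`e₁^{Γ_tr} = n + n(n−1) = n²`** for every `n` and every number of translates (`H¹(𝒪_X)·id ⊕
H⁰(𝓝′)^Γ`; the companion file IV's `eOne_reducible` is the same number read at one translate). -/
theorem eInvTot_one (n m : ℕ) : eInvTot n m 1 = n ^ 2 := by
  rw [eInvTot, sum_range_succ, sum_range_succ, sum_range_zero, zero_add, Nat.sub_zero, Nat.sub_self,
    eInv_zero_right, Nat.choose_one_right, eInv_one_right, Nat.choose_zero_right, mul_one,
    ← descFactorial_two, Nat.descFactorial_succ, Nat.descFactorial_one]
  rcases n with _ | n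
  · rfl
  · rw [Nat.add_sub_cancel]; ring

/-- §6.D (γ): **`e₂^Γ = C(n,2) + n(n−1)(n−2) + s`** with the crossing classes `s` at their upper bound
`n(n−1)(n−2)(n−3)(m−1)/2 = 12 · C(n,4) · (m−1)` (attained whenever `Γ_tr ⊂ X[2]`, so always for `m = 2`). -/
theorem eInvTot_two (n m : ℕ) :
    eInvTot n m 2 = n.choose 2 + n * (n - 1) * (n - 2) + 12 * n.choose 4 * (m - 1) := by
  rw [eInvTot, sum_range_succ, sum_range_succ, sum_range_succ, sum_range_zero, zero_add, Nat.sub_zero,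
    show 2 - 1 = 1 by rfl, Nat.sub_self, eInv_zero_right, eInv_one_right, Nat.choose_one_right, eInv_two_right,
    Nat.choose_zero_right, mul_one, ← descFactorial_two, Nat.descFactorial_succ, Nat.descFactorial_one,
    choose_two_mul_choose_two]
  ring

/-- §6.D (γ) at `n = 4, 5, 6` (`m ≥ 1` translates, 2-torsion `Γ_tr`): `e₂^Γ = 12m + 18` (`m = d + 1 = 2`: `42` =
habitat1's `12d + 30`), `60m + 10`, `180m − 45` (the last stated without `ℕ`-subtraction). -/
theorem eInvTot_two_values {m : ℕ} (hm : 1 ≤ m) :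
    eInvTot 4 m 2 = 12 * m + 18 ∧ eInvTot 5 m 2 = 60 * m + 10 ∧ eInvTot 6 m 2 + 45 = 180 * m := by
  refine ⟨?_, ?_, ?_⟩ <;> rw [eInvTot_two] <;> simp [Nat.choose] <;> omega

/-- §6.D (ii): `⟨t⟩`-invariants for two 2-torsion translates in `E⁴`: `(1, 16, 42, 16, 1)`. -/
theorem eInvTot_four_two : (List.range 5).map (eInvTot 4 2) = [1, 16, 42, 16, 1] := by decide

/-- §6.D (ii): `χ^Γ = 12` and `χ_ι = Σ_k e_k^Γ = 76` (gs-eng-1 CHI-IOTA §2's holomorphic-Lefschetz value) at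
`n = 4`, `m = 2`. -/
theorem eInvTot_four_two_sums : (eInvTot 4 2 0 : ℤ) - eInvTot 4 2 1 + eInvTot 4 2 2 - eInvTot 4 2 3
      + eInvTot 4 2 4 = 12 ∧ eInvTot 4 2 0 + eInvTot 4 2 1 + eInvTot 4 2 2 + eInvTot 4 2 3 + eInvTot 4 2 4 = 76 := by
  decide

/-- §6.D (ii): `Γ_tr`-invariants at `n = 5`, `m = 2`: `(1, 25, 130, 130, 25, 1)` (`χ^Γ = 0`, odd CY). -/
theorem eInvTot_five_two : (List.range 6).map (eInvTot 5 2) = [1, 25, 130, 130, 25, 1] := by decide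

/-! ## 6. EXT-NOTE §6.E: the target dimension `Σ_q C(n,q) C(n,q+2) = C(2n, n−2)` -/

/-- **§6.E (Vandermonde): `Σ_{q=0}^{n} C(n,q) · C(n,q+2) = C(2n, n+2)`** (`= C(2n, n−2)` for `n ≥ 2`) — the
dimension `Σ_q h^{q,q+2}(Eⁿ)` of the target of `σ^{(2)} : Ext²(F,F)^G → ⊕_q H^{q,q+2}(Eⁿ)`. -/
theorem sum_choose_mul_choose_add_two (n : ℕ) :
    ∑ q ∈ range (n + 1), n.choose q * n.choose (q + 2) = (2 * n).choose (n + 2) := by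
  have h : (2 * n).choose (n + 2) = ∑ k ∈ range (n + 2 + 1), n.choose k * n.choose (n + 2 - k) := by
    rw [two_mul, Nat.add_choose_eq, Finset.Nat.sum_antidiagonal_eq_sum_range_succ_mk]
  rw [h, sum_range_succ' (fun k => n.choose k * n.choose (n + 2 - k)),
    sum_range_succ' (fun k => n.choose (k + 1) * n.choose (n + 2 - (k + 1))),
    show n + 2 - 0 = n + 2 by omega, show n + 2 - (0 + 1) = n + 1 by omega,
    Nat.choose_eq_zero_of_lt (by omega : n < n + 2), Nat.choose_eq_zero_of_lt (by omega : n < n + 1),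
    mul_zero, mul_zero, add_zero, add_zero]
  refine sum_congr rfl fun q hq => ?_
  rw [mem_range] at hq
  rw [show n + 2 - (q + 1 + 1) = n - q by omega, Nat.choose_symm (by omega), mul_comm]

/-- §6.E: `C(2n, n−2) = 6, 28, 120, 495` for `n = 3, 4, 5, 6`. -/
theorem sum_choose_mul_choose_add_two_values :
    [3, 4, 5, 6].map (fun n => (2 * n).choose (n + 2)) = [6, 28, 120, 495] := by decide

/-! ## 7. The mechanism of §6.D(i): opposite scalars kill every differential -/

section Degeneration
variable {K V V' : Type*} [Field K] [NeZero (2 : K)] [AddCommGroup V] [Module K V] [AddCommGroup V'] [Module K V']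

/-- **EXT-NOTE §6.D(i)(α), the one-line mechanism.** If an automorphism `g` acts on the source as the scalar `ε`
and on the target as `−ε` (`ε ≠ 0`; there `ε = (−1)^{p+q}` on `E_r^{p,q}`, `−ε` on `E_r^{p+r,q−r+1}`), then every
`g`-equivariant linear map between them — every differential `d_r` — is zero (characteristic `≠ 2`). -/
theorem eq_zero_of_smul_eq_neg_smul (f : V →ₗ[K] V') {ε : K} (hε : ε ≠ 0)
    (h : ∀ v, f (ε • v) = -(ε • f v)) : f = 0 := by
  ext v
  have h1 : ε • f v = -(ε • f v) := by have h' := h v; rwa [map_smul] at h'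
  have h2 : (2 : K) • (ε • f v) = 0 := by rw [two_smul]; nth_rw 2 [h1]; exact add_neg_cancel _
  rw [smul_smul, smul_eq_zero] at h2
  rcases h2 with h2 | h2
  · exact absurd h2 (mul_ne_zero (NeZero.ne 2) hε)
  · exact h2
end Degeneration

/-! ## 8. Dictionary: the third factor is the tree's Hodge number `h^{0,p}` of an abelian variety -/

section HodgeNumber
open Literature.AlgebraicGeometry.HodgeTheory Literature.AlgebraicGeometry.Motives

/-- **`E₂^{p,q}(n, m) = C(m, q) · #(oriented q-fold crossing types) · h^{0,p}(A)`** for EVERY complex abelian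
variety `A` of dimension `n − 2q` (tree carrier `Motives.AbelianVariety ℂ`, any Hodge model `B`; that the crossing
loci `B_1 ∩ ⋯ ∩ B_q ≅ E^{n−2q}` are such is the binder, `h^{0,p}(A) = C(g,0)·C(g,p)` is the tree's theorem). -/
theorem ePage_eq_mul_finrank_typePiece {n q : ℕ} (m p : ℕ) (A : AbelianVariety ℂ) (B : HodgeModel A.dim A.X)
    (hA : A.dim = n - 2 * q) :
    ePage n m p q = m.choose q * Fintype.card (OrientedCrossingType n q)
      * Module.finrank ℂ (B.typePiece p ⟨(0, p), Finset.HasAntidiagonal.mem_antidiagonal.2 (zero_add p)⟩) := by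
  rw [HodgeModel.finrank_typePiece_eq_choose_mul_choose A B p, card_orientedCrossingType, ePage, hA,
    Nat.choose_zero_right, one_mul]
end HodgeNumber

end Summit.Ventures.HSemireg.ObstructionLocus.GlobalCount
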